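import Summits.AnomalousDissipation.AnomalousDissipation.Theorems.EulerLimitLoudTightSlabTools

/-!
# Route EulerLimit (AnomalousDissipation) — the reduction `stub_loudSpaceTightFamily → stub_loudTightFamily`
# (crux `EulerlimitThesisV2`, line `tight`, registered stub `stub_loudTightOfSpaceTight`)

Helper file (`--supports stmt-AnomalousDissipation-0511`) proving the registered reduction stub
`stub_loudTightOfSpaceTight : R → H` of line `tight` (STUB-PLAN `stub_loudTightFamily`, top plan
SHRINK, item R2), where `H = stub_loudTightFamily` is the line's heart (a loud, energy-bounded,
`L³`-bounded, `τ`-periodic classical Navier–Stokes family with one steady force, `ν_j → 0`, that is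
`L³((0,τ) × 𝕋³)`-equicontinuous under SPACE–TIME translations) and `R = stub_loudSpaceTightFamily`
is its space-only residual (no `L³`-mass clause, modulus under SPACE translations only).  Since
`H → R` is the slice `s = 0`, the two are equivalent: time tightness is slaved to the equation.

* `loudTight_timeModulus_of_spaceModulus` (L4, load-bearing) — for same-force classical families
  with `|ν_j| ≤ νmax`, energies `≤ E` and a uniform slab `L³` space modulus, the slab `L³` time
  modulus is uniform too.  Clone of the tree's Fourier-side Aubin–Lions–Simon argument
  `Torus.exists_forall_lintegral_sub_pow_three_le_of_modes` with the Besov input replaced by the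
  space modulus (slab CET (6), `loudTight_slab_mollify_sub_self_le`) and the mode-Cauchy input by
  the same-force mode-Lipschitz bound `loudTight_modeLipschitz` (Simon 1987, §8 Thm. 5;
  Robinson–Rodrigo–Sadowski 2016, Thm. 4.4 Step 3; De Rosa–Isett 2024, §6.1);
* `stub_loudTightOfSpaceTight` (L5) — the assembly: `νmax` from `ν_j → 0`, the mass bound from
  `loudTight_slabMass_le`, the joint modulus from L0 (period-window shift) + L4 + Minkowski.

Theorem-only; tools from `Theorems/EulerLimitLoudTightSlabTools.lean`.  The local notation
`𝕋³`/`E³` is the skeleton's (`Cruxes/EulerlimitThesisV2/Lines/tight.lean`), in which the registered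
stub texts are written.
-/

noncomputable section

-- D-0017: single-problem summit ⇒ the duplicated namespace segment is by design.
set_option linter.dupNamespace false

open MeasureTheory Set Filter Function UnitAddTorus Topology
open scoped ENNReal NNReal Convolution ContDiff

namespace Summit.AnomalousDissipation.AnomalousDissipation.Theorems

open Literature.Analysis.FunctionSpaces Literature.Analysis.FunctionSpaces.Torus

/-- The physical flat unit torus `𝕋³` (local notation, as in the skeleton of line `tight`). -/
local notation "𝕋³" => UnitAddTorus (Fin 3)
/-- Velocity values (local notation, as in the skeleton of line `tight`). -/
local notation "E³" => EuclideanSpace ℝ (Fin 3)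

/-! ## Small tools: tolerances, time and space translates -/

/-- Choice of a small tolerance: for `0 < c` in `ℝ≥0∞` there is a real `a > 0` with
`2 · (ofReal a)^{1/3} ≤ c`. [folklore] -/
theorem loudTight_exists_two_mul_rpow_third_le {c : ℝ≥0∞} (hc : 0 < c) :
    ∃ a : ℝ, 0 < a ∧ 2 * ENNReal.ofReal a ^ (1 / 3 : ℝ) ≤ c := by
  have h1 : Tendsto (fun a : ℝ => a ^ (1 / 3 : ℝ)) (𝓝[>] 0) (𝓝 0) := by
    have h := (Real.continuousAt_rpow_const 0 (1 / 3 : ℝ) (Or.inr (by norm_num))).tendsto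
    rw [Real.zero_rpow (by norm_num)] at h
    exact h.mono_left nhdsWithin_le_nhds
  have h2 : Tendsto (fun a : ℝ => 2 * ENNReal.ofReal (a ^ (1 / 3 : ℝ))) (𝓝[>] 0) (𝓝 0) := by
    have h := ENNReal.Tendsto.const_mul (ENNReal.tendsto_ofReal h1)
      (Or.inr (by norm_num : (2 : ℝ≥0∞) ≠ ⊤))
    simpa using h
  have hev1 : ∀ᶠ a in 𝓝[>] (0 : ℝ), 0 < a := eventually_mem_nhdsWithin
  have hev2 : ∀ᶠ a in 𝓝[>] (0 : ℝ), 2 * ENNReal.ofReal (a ^ (1 / 3 : ℝ)) ≤ c :=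
    h2.eventually (ge_mem_nhds hc)
  obtain ⟨a, ha, ha'⟩ := (hev1.and hev2).exists
  refine ⟨a, ha, ?_⟩
  rw [ENNReal.ofReal_rpow_of_nonneg ha.le (by norm_num)]
  exact ha'

/-- Time translates of fields jointly smooth on `ℝ × 𝕋³` are jointly smooth. [folklore] -/
theorem loudTight_isSmoothSpaceTimeOn_comp_add {F : Type*} [NormedAddCommGroup F]
    [NormedSpace ℝ F] {u : ℝ → 𝕋³ → F} (hu : IsSmoothSpaceTimeOn univ u) (s : ℝ) :
    IsSmoothSpaceTimeOn univ (fun t => u (t + s)) := by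
  unfold IsSmoothSpaceTimeOn at hu ⊢
  rw [univ_prod_univ] at hu ⊢
  have hmap : ContDiff ℝ ∞ (fun z : ℝ × EuclideanSpace ℝ (Fin 3) => (z.1 + s, z.2)) :=
    (contDiff_fst.add contDiff_const).prodMk contDiff_snd
  have e : stLift (fun t => u (t + s)) =
      stLift u ∘ fun z : ℝ × EuclideanSpace ℝ (Fin 3) => (z.1 + s, z.2) := by
    funext z
    rfl
  rw [e]
  exact ((contDiffOn_univ.1 hu).comp hmap).contDiffOn

/-- Space translates of fields jointly smooth on `ℝ × 𝕋³` are jointly smooth. [folklore] -/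
theorem loudTight_isSmoothSpaceTimeOn_comp_add_space {F : Type*} [NormedAddCommGroup F]
    [NormedSpace ℝ F] {u : ℝ → 𝕋³ → F} (hu : IsSmoothSpaceTimeOn univ u) (h : 𝕋³) :
    IsSmoothSpaceTimeOn univ (fun t x => u t (x + h)) := by
  obtain ⟨b, rfl⟩ := proj_surjective h
  unfold IsSmoothSpaceTimeOn at hu ⊢
  rw [univ_prod_univ] at hu ⊢
  have hmap : ContDiff ℝ ∞ (fun z : ℝ × EuclideanSpace ℝ (Fin 3) => (z.1, z.2 + b)) :=
    contDiff_fst.prodMk (contDiff_snd.add contDiff_const)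
  have e : stLift (fun t x => u t (x + proj b)) =
      stLift u ∘ fun z : ℝ × EuclideanSpace ℝ (Fin 3) => (z.1, z.2 + b) := by
    funext z
    rfl
  rw [e]
  exact ((contDiffOn_univ.1 hu).comp hmap).contDiffOn

/-! ## L4 — the time modulus from the space modulus and the equation -/

/-- **L4 (LOAD-BEARING: time tightness is slaved to the Navier–Stokes equation).** Let
`(us j, ps j)` be classical solutions of `NS(ν_j, f)` on `ℝ × 𝕋³` with ONE steady force `f`,
`|ν_j| ≤ νmax`, `τ`-periodic in time, with energies `∫‖us j(t)‖² ≤ E`, and with a slab `L³`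
SPACE-translation modulus that is uniform in `j`.  Then the slab `L³` TIME-translation modulus
is uniform in `j` as well: for every `ε > 0` there is `δ > 0` with
`∫₀^τ∫‖us j(t + s, x) − us j(t, x)‖³ ≤ ε` for all `j` and `|s| ≤ δ`.
Proof (clone of the tree's `Torus.exists_forall_lintegral_sub_pow_three_le_of_modes`, Fourier
side of the Aubin–Lions–Simon argument): with `ρ_η = Torus.kernel η`,
`u(·+s) − u = [ρ_η⋆u(·+s) − ρ_η⋆u] + [ρ_η⋆u − u] − [ρ_η⋆u(·+s) − u(·+s)]`; the two mollification
errors have slab norm `≤ a^{1/3}` by slab CET (6) (L2; the shifted window is moved back by L0 and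
periodicity); the mollified difference is bounded POINTWISE by
`∑_{|k|≤K}‖û(t+s,k) − û(t,k)‖ + (∫‖u(t+s) − u(t)‖) τ_K(η) ≤ |s| Λ_K + (1 + E) τ_K(η)`
(`Torus.norm_kernel_convolution_apply_le`, the mode-Lipschitz bound L1, the Fourier tail
`Torus.tendsto_tsum_compl_norm_mFourierCoeff_kernel`); choose `a`, then `K`, then `δ`.
(Simon 1987, §8 Thm. 5; Robinson–Rodrigo–Sadowski 2016, Thm. 4.11 / Thm. 4.4 Step 3;
De Rosa–Isett 2024, §6.1.) [cite: Simon1986, §8 Thm. 5] -/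
theorem loudTight_timeModulus_of_spaceModulus {f : 𝕋³ → E³} {τ E νmax : ℝ} (hτ : 0 < τ)
    {ν : ℕ → ℝ} {us : ℕ → ℝ → 𝕋³ → E³} {ps : ℕ → ℝ → 𝕋³ → ℝ}
    (hν : ∀ j, |ν j| ≤ νmax)
    (hcl : ∀ j, IsClassicalNSSolutionOn univ (ν j) (fun _ => f) (us j) (ps j))
    (hper : ∀ j, Periodic (us j) τ)
    (hE : ∀ j t, ∫ x, ‖us j t x‖ ^ 2 ≤ E)
    (hspace : ∀ ε : ℝ, 0 < ε → ∃ δ : ℝ, 0 < δ ∧ ∀ (j : ℕ) (h : 𝕋³), ‖h‖ ≤ δ →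
      ∫⁻ t in Ioo 0 τ, ∫⁻ x, ‖us j t (x + h) - us j t x‖ₑ ^ 3 ≤ ENNReal.ofReal ε)
    {ε : ℝ} (hε : 0 < ε) :
    ∃ δ : ℝ, 0 < δ ∧ ∀ (j : ℕ) (s : ℝ), |s| ≤ δ →
      ∫⁻ t in Ioo 0 τ, ∫⁻ x, ‖us j (t + s) x - us j t x‖ₑ ^ 3 ≤ ENNReal.ofReal ε := by
  classical
  set ρ : ℝ≥0∞ := ENNReal.ofReal ε ^ (1 / 3 : ℝ) with hρ
  have hρpos : 0 < ρ := ENNReal.rpow_pos_of_nonneg (ENNReal.ofReal_pos.2 hε) (by norm_num)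
  have hρ3 : 0 < ρ / 3 := ENNReal.div_pos hρpos.ne' (by norm_num)
  -- Step 1: the tolerance `a` of the space modulus and the mollification scale `η`
  obtain ⟨a, ha, ha'⟩ := loudTight_exists_two_mul_rpow_third_le hρ3
  obtain ⟨δ₁, hδ₁, hmod⟩ := hspace a ha
  set η : ℝ := min δ₁ (1 / 4) with hη
  have hη0 : 0 < η := lt_min hδ₁ (by norm_num)
  have hη4 : η ≤ 1 / 4 := min_le_right _ _
  have hηδ : η ≤ δ₁ := min_le_left _ _
  -- Step 2: the mode-Lipschitz constants and the sign of `E`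
  obtain ⟨L, hL0, hL⟩ := loudTight_modeLipschitz f E νmax
  have hE0 : 0 ≤ E := (integral_nonneg fun _ => by positivity).trans (hE 0 0)
  -- Step 3: the truncation order `K` from the Fourier tail of the mollifier
  set T : ℕ → ℝ := fun K => ∑' k : {k // k ∉ freqBall (d := Fin 3) K},
    ‖mFourierCoeff (fun y => (kernel η y : ℂ)) (k : Fin 3 → ℤ)‖ with hT
  have hT0 : ∀ K, 0 ≤ T K := fun K => tsum_nonneg fun _ => norm_nonneg _
  set τ3 : ℝ≥0∞ := ENNReal.ofReal τ ^ (1 / 3 : ℝ) with hτ3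
  have hτ3top : τ3 ≠ ⊤ := ENNReal.rpow_ne_top_of_nonneg (by norm_num) ENNReal.ofReal_ne_top
  obtain ⟨K, hK⟩ : ∃ K : ℕ, τ3 * ENNReal.ofReal ((1 + E) * T K) ≤ ρ / 3 := by
    have h1 : Tendsto (fun K => ENNReal.ofReal ((1 + E) * T K)) atTop (𝓝 0) := by
      have h := (tendsto_tsum_compl_norm_mFourierCoeff_kernel (d := Fin 3) η).const_mul (1 + E)
      rw [mul_zero] at h
      simpa using ENNReal.tendsto_ofReal h
    have h2 : Tendsto (fun K => τ3 * ENNReal.ofReal ((1 + E) * T K)) atTop (𝓝 0) := by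
      have h := ENNReal.Tendsto.const_mul h1 (Or.inr hτ3top)
      simpa using h
    exact (h2.eventually (ge_mem_nhds hρ3)).exists
  -- Step 4: the time step `δ`
  set Λ : ℝ := ∑ k ∈ freqBall (d := Fin 3) K, L k with hΛ
  have hΛ0 : 0 ≤ Λ := Finset.sum_nonneg fun k _ => hL0 k
  obtain ⟨δ, hδ, hδ'⟩ : ∃ δ : ℝ, 0 < δ ∧ τ3 * ENNReal.ofReal (δ * Λ) ≤ ρ / 3 := by
    have h1 : Tendsto (fun δ : ℝ => ENNReal.ofReal (δ * Λ)) (𝓝[>] 0) (𝓝 0) := by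
      have h : Tendsto (fun δ : ℝ => δ * Λ) (𝓝 0) (𝓝 (0 * Λ)) := tendsto_id.mul_const Λ
      rw [zero_mul] at h
      simpa using (ENNReal.tendsto_ofReal h).mono_left nhdsWithin_le_nhds
    have h2 : Tendsto (fun δ : ℝ => τ3 * ENNReal.ofReal (δ * Λ)) (𝓝[>] 0) (𝓝 0) := by
      have h := ENNReal.Tendsto.const_mul h1 (Or.inr hτ3top)
      simpa using h
    have hev1 : ∀ᶠ δ in 𝓝[>] (0 : ℝ), 0 < δ := eventually_mem_nhdsWithin
    obtain ⟨δ, h3, h4⟩ := (hev1.and (h2.eventually (ge_mem_nhds hρ3))).exists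
    exact ⟨δ, h3, h4⟩
  refine ⟨δ, hδ, fun j s hs => ?_⟩
  -- Step 5: notation for the pair `(j, s)`
  have hus : IsSmoothSpaceTimeOn univ (us j) := (hcl j).smooth_velocity
  have huss : IsSmoothSpaceTimeOn univ (fun t => us j (t + s)) :=
    loudTight_isSmoothSpaceTimeOn_comp_add hus s
  set P : ℝ → 𝕋³ → E³ := fun t x => (kernel η ⋆ us j t) x - us j t x with hP
  set Q : ℝ → 𝕋³ → E³ := fun t x => (kernel η ⋆ us j (t + s)) x - (kernel η ⋆ us j t) x with hQ
  set D : ℝ → 𝕋³ → E³ := fun t x => us j (t + s) x - us j t x with hD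
  -- smoothness, continuity, measurability
  have hmol : IsSmoothSpaceTimeOn univ (fun t => kernel η ⋆ us j t) :=
    loudTight_isSmoothSpaceTimeOn_mollify hus hη0 hη4
  have hmols : IsSmoothSpaceTimeOn univ (fun t => kernel η ⋆ us j (t + s)) :=
    loudTight_isSmoothSpaceTimeOn_mollify huss hη0 hη4
  have cu := loudTight_continuous_uncurry hus
  have cus := loudTight_continuous_uncurry huss
  have cm := loudTight_continuous_uncurry hmol
  have cms := loudTight_continuous_uncurry hmols
  set μT : Measure (ℝ × 𝕋³) := (volume.restrict (Ioo 0 τ)).prod volume with hμT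
  have hmPs : AEStronglyMeasurable (uncurry fun t x => P (t + s) x) μT :=
    (cms.sub cus).aestronglyMeasurable
  have hmP : AEStronglyMeasurable (uncurry P) μT := (cm.sub cu).aestronglyMeasurable
  have hmQ : AEStronglyMeasurable (uncurry Q) μT := (cms.sub cm).aestronglyMeasurable
  have hmQP : AEStronglyMeasurable (uncurry fun t x => Q t x + P t x) μT := hmQ.add hmP
  -- (i) decomposition and Minkowski
  have hdecomp : ∀ t x, us j (t + s) x - us j t x = (Q t x + P t x) - P (t + s) x := by
    intro t x
    simp only [hP, hQ]
    abel
  have hMink : (∫⁻ t in Ioo 0 τ, ∫⁻ x, ‖us j (t + s) x - us j t x‖ₑ ^ 3) ^ (1 / 3 : ℝ) ≤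
      (∫⁻ t in Ioo 0 τ, ∫⁻ x, ‖Q t x‖ₑ ^ 3) ^ (1 / 3 : ℝ) +
        (∫⁻ t in Ioo 0 τ, ∫⁻ x, ‖P t x‖ₑ ^ 3) ^ (1 / 3 : ℝ) +
          (∫⁻ t in Ioo 0 τ, ∫⁻ x, ‖P (t + s) x‖ₑ ^ 3) ^ (1 / 3 : ℝ) := by
    calc (∫⁻ t in Ioo 0 τ, ∫⁻ x, ‖us j (t + s) x - us j t x‖ₑ ^ 3) ^ (1 / 3 : ℝ)
        = (∫⁻ t in Ioo 0 τ, ∫⁻ x, ‖(Q t x + P t x) - P (t + s) x‖ₑ ^ 3) ^ (1 / 3 : ℝ) := by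
          simp_rw [hdecomp]
      _ ≤ (∫⁻ t in Ioo 0 τ, ∫⁻ x, ‖Q t x + P t x‖ₑ ^ 3) ^ (1 / 3 : ℝ) +
            (∫⁻ t in Ioo 0 τ, ∫⁻ x, ‖P (t + s) x‖ₑ ^ 3) ^ (1 / 3 : ℝ) :=
          rpow_lintegral_sub_le hmQP hmPs
      _ ≤ _ := by
          gcongr ?_ + _
          exact rpow_lintegral_add_le hmQ hmP
  -- (ii) the two mollification errors (slab CET (6); the shifted window by periodicity)
  have hPa : ∫⁻ t in Ioo 0 τ, ∫⁻ x, ‖P t x‖ₑ ^ 3 ≤ ENNReal.ofReal a :=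
    loudTight_slab_mollify_sub_self_le hus hη0 hη4 fun h hh => hmod j h (hh.trans hηδ)
  have hPsa : ∫⁻ t in Ioo 0 τ, ∫⁻ x, ‖P (t + s) x‖ₑ ^ 3 ≤ ENNReal.ofReal a := by
    have hperP : Periodic (fun t => ∫⁻ x, ‖P t x‖ₑ ^ 3) τ := by
      intro t
      simp only [hP, hper j t]
    exact (loudTight_setLIntegral_Ioo_comp_add_of_periodic hτ hperP s).trans_le hPa
  -- (iii) the mollified time difference: a pointwise bound, uniform in `(t, x)`
  have hslice : ∀ t, IsSmooth (us j t) := fun t => hus.isSmooth_slice (mem_univ t)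
  have hDslice : ∀ t, IsSmooth (D t) := fun t => (hslice (t + s)).sub (hslice t)
  have hQeq : ∀ t x, Q t x = (kernel η ⋆ D t) x := fun t x =>
    (kernel_convolution_sub_right hη0 hη4 (hslice (t + s)).continuous (hslice t).continuous x).symm
  have hL1 : ∀ t, ∫ y, ‖us j t y‖ ≤ (1 + E) / 2 := fun t =>
    (loudTight_integral_norm_le_half_one_add (hslice t).continuous).trans (by linarith [hE j t])
  set q : ℝ := δ * Λ + (1 + E) * T K with hq
  have hq0 : 0 ≤ q := add_nonneg (mul_nonneg hδ.le hΛ0) (mul_nonneg (by linarith) (hT0 K))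
  have hQpt : ∀ t x, ‖Q t x‖ ≤ q := by
    intro t x
    rw [hQeq t x]
    refine (norm_kernel_convolution_apply_le (hDslice t) hη0 hη4 K x).trans ?_
    have h1 : ∀ k, ‖mFourierCoeff (EuclideanSpace.complexify ∘ D t) k‖ ≤ δ * L k := by
      intro k
      have e1 : (EuclideanSpace.complexify ∘ D t) =
          EuclideanSpace.complexify ∘ us j (t + s) - EuclideanSpace.complexify ∘ us j t := by
        funext y
        simp [hD, map_sub]
      rw [e1, mFourierCoeff_sub]
      · calc _ ≤ |t + s - t| * L k := hL (ν j) (us j) (ps j) (hcl j) (hν j) (hE j) k t (t + s)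
          _ = |s| * L k := by rw [add_sub_cancel_left]
          _ ≤ δ * L k := mul_le_mul_of_nonneg_right hs (hL0 k)
      · exact EuclideanSpace.complexify.toContinuousLinearMap.integrable_comp
          (hslice (t + s)).integrable
      · exact EuclideanSpace.complexify.toContinuousLinearMap.integrable_comp (hslice t).integrable
    have h2 : ∫ y, ‖D t y‖ ≤ 1 + E := by
      have i1 : Integrable (fun y => ‖us j (t + s) y‖) volume :=
        (hslice (t + s)).continuous.norm.integrable_unitAddTorus
      have i2 : Integrable (fun y => ‖us j t y‖) volume :=
        (hslice t).continuous.norm.integrable_unitAddTorus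
      calc ∫ y, ‖D t y‖ ≤ ∫ y, ‖us j (t + s) y‖ + ‖us j t y‖ :=
            integral_mono (hDslice t).continuous.norm.integrable_unitAddTorus (i1.add i2)
              fun y => norm_sub_le _ _
        _ = (∫ y, ‖us j (t + s) y‖) + ∫ y, ‖us j t y‖ := integral_add i1 i2
        _ ≤ (1 + E) / 2 + (1 + E) / 2 := add_le_add (hL1 _) (hL1 _)
        _ = 1 + E := by ring
    have hD0 : 0 ≤ ∫ y, ‖D t y‖ := integral_nonneg fun _ => norm_nonneg _
    calc ∑ k ∈ freqBall K, ‖mFourierCoeff (EuclideanSpace.complexify ∘ D t) k‖ +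
          (∫ y, ‖D t y‖) * T K
        ≤ ∑ k ∈ freqBall K, δ * L k + (1 + E) * T K :=
          add_le_add (Finset.sum_le_sum fun k _ => h1 k) (mul_le_mul_of_nonneg_right h2 (hT0 K))
      _ = q := by rw [hq, hΛ, Finset.mul_sum]
  -- the slab norm of the mollified difference
  have hQL3 : (∫⁻ t in Ioo 0 τ, ∫⁻ x, ‖Q t x‖ₑ ^ 3) ^ (1 / 3 : ℝ) ≤ τ3 * ENNReal.ofReal q := by
    have h1 : ∫⁻ t in Ioo 0 τ, ∫⁻ x, ‖Q t x‖ₑ ^ 3 ≤ ENNReal.ofReal q ^ 3 * ENNReal.ofReal τ := by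
      calc ∫⁻ t in Ioo 0 τ, ∫⁻ x, ‖Q t x‖ₑ ^ 3 ≤ ∫⁻ t in Ioo 0 τ, ∫⁻ _x : 𝕋³, ENNReal.ofReal q ^ 3 :=
            lintegral_mono fun t => lintegral_mono fun x => by
              gcongr
              rw [← ofReal_norm]
              exact ENNReal.ofReal_le_ofReal (hQpt t x)
        _ = ENNReal.ofReal q ^ 3 * ENNReal.ofReal τ := by
            rw [lintegral_lintegral_const_right, setLIntegral_const, Real.volume_Ioo, sub_zero]
    calc (∫⁻ t in Ioo 0 τ, ∫⁻ x, ‖Q t x‖ₑ ^ 3) ^ (1 / 3 : ℝ)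
        ≤ (ENNReal.ofReal q ^ 3 * ENNReal.ofReal τ) ^ (1 / 3 : ℝ) := rpow_third_le_rpow_third h1
      _ = ENNReal.ofReal q * τ3 := rpow_third_pow_three_mul _ _
      _ = τ3 * ENNReal.ofReal q := mul_comm _ _
  -- (iv) conclusion
  have hq' : τ3 * ENNReal.ofReal q ≤ ρ / 3 + ρ / 3 := by
    rw [hq, ENNReal.ofReal_add (mul_nonneg hδ.le hΛ0) (mul_nonneg (by linarith) (hT0 K)), mul_add]
    exact add_le_add hδ' hK
  have ha3 : ENNReal.ofReal a ^ (1 / 3 : ℝ) + ENNReal.ofReal a ^ (1 / 3 : ℝ) ≤ ρ / 3 := by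
    rw [← two_mul]
    exact ha'
  have hfinal : (∫⁻ t in Ioo 0 τ, ∫⁻ x, ‖us j (t + s) x - us j t x‖ₑ ^ 3) ^ (1 / 3 : ℝ) ≤ ρ := by
    calc (∫⁻ t in Ioo 0 τ, ∫⁻ x, ‖us j (t + s) x - us j t x‖ₑ ^ 3) ^ (1 / 3 : ℝ)
        ≤ τ3 * ENNReal.ofReal q + ENNReal.ofReal a ^ (1 / 3 : ℝ) +
            ENNReal.ofReal a ^ (1 / 3 : ℝ) :=
          hMink.trans (add_le_add (add_le_add hQL3 (rpow_third_le_rpow_third hPa))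
            (rpow_third_le_rpow_third hPsa))
      _ = τ3 * ENNReal.ofReal q + (ENNReal.ofReal a ^ (1 / 3 : ℝ) +
            ENNReal.ofReal a ^ (1 / 3 : ℝ)) := add_assoc _ _ _
      _ ≤ (ρ / 3 + ρ / 3) + ρ / 3 := add_le_add hq' ha3
      _ = ρ := ENNReal.add_thirds ρ
  have hcube : ∀ b : ℝ≥0∞, (b ^ (1 / 3 : ℝ)) ^ 3 = b := fun b => by
    rw [show (1 / 3 : ℝ) = ((3 : ℕ) : ℝ)⁻¹ by norm_num, ENNReal.rpow_inv_natCast_pow (by norm_num)]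
  calc ∫⁻ t in Ioo 0 τ, ∫⁻ x, ‖us j (t + s) x - us j t x‖ₑ ^ 3
      = ((∫⁻ t in Ioo 0 τ, ∫⁻ x, ‖us j (t + s) x - us j t x‖ₑ ^ 3) ^ (1 / 3 : ℝ)) ^ 3 :=
        (hcube _).symm
    _ ≤ ρ ^ 3 := by gcongr
    _ = ENNReal.ofReal ε := hcube _

/-! ## L5 — the assembly `R → H`: the registered reduction stub -/

/-- **Registered stub `stub_loudTightOfSpaceTight` (STUB-PLAN `stub_loudTightFamily`, item R2):
the reduction `stub_loudSpaceTightFamily → stub_loudTightFamily`** of line `tight` of crux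
`EulerLimit.EulerlimitThesisV2` (stmt-AnomalousDissipation-0511).  If one steady smooth force drives,
for viscosities `ν_j → 0`, `τ`-periodic classical Navier–Stokes flows with energies `≤ E`,
period inputs `≥ c > 0` and a slab `L³` SPACE-translation modulus uniform in `j`, then the same
family also has a uniform slab `L³` mass bound (L3, at one scale of the modulus) and a uniform
JOINT space–time `L³`-translation modulus: `u(t+s, x+h) − u(t, x) = [u(t+s, x+h) − u(t+s, x)] +
[u(t+s, x) − u(t, x)]`, the first piece controlled by the space modulus after shifting the
period window (L0), the second by the time modulus slaved to the equation (L4); Minkowski in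
`L³((0,τ) × 𝕋³)`.  Hence the residual `R` (space-only tightness, no mass clause) implies the
line's stub `H = stub_loudTightFamily` verbatim (and `H → R` is the slice `s = 0`). [folklore] -/
theorem stub_loudTightOfSpaceTight :
    (∃ f : 𝕋³ → E³, Literature.Analysis.FunctionSpaces.Torus.IsSmooth f ∧ Literature.Analysis.FunctionSpaces.Torus.IsDivFree f ∧ Literature.Analysis.FunctionSpaces.Torus.HasZeroMean f ∧ ∃ (τ c E : ℝ), 0 < τ ∧ 0 < c ∧ ∃ (ν : ℕ → ℝ) (us : ℕ → ℝ → 𝕋³ → E³) (ps : ℕ → ℝ → 𝕋³ → ℝ), (∀ j, 0 < ν j) ∧ Filter.Tendsto ν Filter.atTop (nhds 0) ∧ (∀ j, Literature.Analysis.FunctionSpaces.Torus.IsClassicalNSSolutionOn Set.univ (ν j) (fun _ => f) (us j) (ps j) ∧ Function.Periodic (us j) τ) ∧ (∀ j t, ∫ x, ‖us j t x‖ ^ 2 ≤ E) ∧ (∀ j, c ≤ ∫ t in (0 : ℝ)..τ, MeasureTheory.integral MeasureTheory.volume (fun x => inner ℝ (f x) (us j t x))) ∧ (∀ ε : ℝ,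 0 < ε → ∃ δ : ℝ, 0 < δ ∧ ∀ (j : ℕ) (h : 𝕋³), ‖h‖ ≤ δ → ∫⁻ t in Set.Ioo 0 τ, ∫⁻ x, ‖us j t (x + h) - us j t x‖ₑ ^ 3 ≤ ENNReal.ofReal ε)) → ∃ f : 𝕋³ → E³, Literature.Analysis.FunctionSpaces.Torus.IsSmooth f ∧ Literature.Analysis.FunctionSpaces.Torus.IsDivFree f ∧ Literature.Analysis.FunctionSpaces.Torus.HasZeroMean f ∧ ∃ (τ c E M : ℝ), 0 < τ ∧ 0 < c ∧ ∃ (ν : ℕ → ℝ) (us : ℕ → ℝ → 𝕋³ → E³) (ps : ℕ → ℝ → 𝕋³ → ℝ), (∀ j, 0 < ν j) ∧ Filter.Tendsto ν Filter.atTop (nhds 0) ∧ (∀ j, Literature.Analysis.FunctionSpaces.Torus.IsClassicalNSSolutionOn Set.univ (ν j) (fun _ => f) (us j) (ps j) ∧ Function.Periodic (us j) τ) ∧ (∀ j t, ∫ x, ‖us j t x‖ ^ 2 ≤ E) ∧ (∀ j, ∫⁻ t in Set.Ioo 0 τ, ∫⁻ x, ‖us j t x‖ₑ ^ 3 ≤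 ENNReal.ofReal M) ∧ (∀ j, c ≤ ∫ t in (0 : ℝ)..τ, MeasureTheory.integral MeasureTheory.volume (fun x => inner ℝ (f x) (us j t x))) ∧ (∀ ε : ℝ, 0 < ε → ∃ δ : ℝ, 0 < δ ∧ ∀ (j : ℕ) (s : ℝ) (h : 𝕋³), |s| ≤ δ → ‖h‖ ≤ δ → ∫⁻ t in Set.Ioo 0 τ, ∫⁻ x, ‖us j (t + s) (x + h) - us j t x‖ₑ ^ 3 ≤ ENNReal.ofReal ε) := by
  rintro ⟨f, hf, hdf, hmf, τ, c, E, hτ, hc, ν, us, ps, hν, hν0, hcl, hE, hin, hspace⟩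
  -- a viscosity ceiling
  obtain ⟨νmax, hνmax⟩ := hν0.bddAbove_range
  have hνb : ∀ j, |ν j| ≤ νmax := fun j => by
    rw [abs_of_pos (hν j)]
    exact hνmax ⟨j, rfl⟩
  -- the mass bound `M` from the energy and the modulus at tolerance `1` (L3)
  obtain ⟨δ₁, hδ₁, hmod₁⟩ := hspace 1 one_pos
  set δ₀ : ℝ := min δ₁ (1 / 4) with hδ₀
  have hδ₀0 : 0 < δ₀ := lt_min hδ₁ (by norm_num)
  have hδ₀4 : δ₀ ≤ 1 / 4 := min_le_right _ _
  obtain ⟨M, hM⟩ := loudTight_slabMass_le τ E hδ₀0 hδ₀4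
  have hmass : ∀ j, ∫⁻ t in Ioo 0 τ, ∫⁻ x, ‖us j t x‖ₑ ^ 3 ≤ ENNReal.ofReal M := fun j =>
    hM (us j) (hcl j).1.smooth_velocity (hE j) fun h hh => by
      have h1 := hmod₁ j h (hh.trans (min_le_left _ _))
      rwa [ENNReal.ofReal_one] at h1
  refine ⟨f, hf, hdf, hmf, τ, c, E, M, hτ, hc, ν, us, ps, hν, hν0, hcl, hE, hmass, hin,
    fun ε hε => ?_⟩
  -- the joint modulus from the space modulus (L0) and the time modulus (L4)
  have hρ : 0 < ENNReal.ofReal ε ^ (1 / 3 : ℝ) :=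
    ENNReal.rpow_pos_of_nonneg (ENNReal.ofReal_pos.2 hε) (by norm_num)
  obtain ⟨a, ha, ha'⟩ := loudTight_exists_two_mul_rpow_third_le hρ
  obtain ⟨δa, hδa, hA⟩ := hspace a ha
  obtain ⟨δb, hδb, hB⟩ := loudTight_timeModulus_of_spaceModulus hτ hνb (fun j => (hcl j).1)
    (fun j => (hcl j).2) hE hspace ha
  refine ⟨min δa δb, lt_min hδa hδb, fun j s h hs hh => ?_⟩
  have hs' : |s| ≤ δb := hs.trans (min_le_right _ _)
  have hh' : ‖h‖ ≤ δa := hh.trans (min_le_left _ _)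
  have hus : IsSmoothSpaceTimeOn univ (us j) := (hcl j).1.smooth_velocity
  -- the two pieces
  set A : ℝ → 𝕋³ → E³ := fun t x => us j (t + s) (x + h) - us j (t + s) x with hAdef
  set B : ℝ → 𝕋³ → E³ := fun t x => us j (t + s) x - us j t x with hBdef
  have hdecomp : ∀ t x, us j (t + s) (x + h) - us j t x = A t x + B t x := by
    intro t x
    simp only [hAdef, hBdef]
    abel
  -- measurability
  have huss := loudTight_isSmoothSpaceTimeOn_comp_add hus s
  have cus := loudTight_continuous_uncurry huss
  have cush := loudTight_continuous_uncurry (loudTight_isSmoothSpaceTimeOn_comp_add_space huss h)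
  have cu := loudTight_continuous_uncurry hus
  set μT : Measure (ℝ × 𝕋³) := (volume.restrict (Ioo 0 τ)).prod volume with hμT
  have hmA : AEStronglyMeasurable (uncurry A) μT := (cush.sub cus).aestronglyMeasurable
  have hmB : AEStronglyMeasurable (uncurry B) μT := (cus.sub cu).aestronglyMeasurable
  -- bounds on the pieces
  have hAa : ∫⁻ t in Ioo 0 τ, ∫⁻ x, ‖A t x‖ₑ ^ 3 ≤ ENNReal.ofReal a := by
    have hperA : Periodic (fun t => ∫⁻ x, ‖us j t (x + h) - us j t x‖ₑ ^ 3) τ := by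
      intro t
      simp only [(hcl j).2 t]
    exact (loudTight_setLIntegral_Ioo_comp_add_of_periodic hτ hperA s).trans_le (hA j h hh')
  have hBa : ∫⁻ t in Ioo 0 τ, ∫⁻ x, ‖B t x‖ₑ ^ 3 ≤ ENNReal.ofReal a := hB j s hs'
  -- Minkowski and conclusion
  have hMink := rpow_lintegral_add_le (T := τ) hmA hmB
  have hfinal : (∫⁻ t in Ioo 0 τ, ∫⁻ x, ‖us j (t + s) (x + h) - us j t x‖ₑ ^ 3) ^ (1 / 3 : ℝ) ≤
      ENNReal.ofReal ε ^ (1 / 3 : ℝ) := by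
    calc (∫⁻ t in Ioo 0 τ, ∫⁻ x, ‖us j (t + s) (x + h) - us j t x‖ₑ ^ 3) ^ (1 / 3 : ℝ)
        = (∫⁻ t in Ioo 0 τ, ∫⁻ x, ‖A t x + B t x‖ₑ ^ 3) ^ (1 / 3 : ℝ) := by simp_rw [hdecomp]
      _ ≤ _ := hMink
      _ ≤ ENNReal.ofReal a ^ (1 / 3 : ℝ) + ENNReal.ofReal a ^ (1 / 3 : ℝ) :=
          add_le_add (rpow_third_le_rpow_third hAa) (rpow_third_le_rpow_third hBa)
      _ = 2 * ENNReal.ofReal a ^ (1 / 3 : ℝ) := (two_mul _).symm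
      _ ≤ ENNReal.ofReal ε ^ (1 / 3 : ℝ) := ha'
  have hcube : ∀ b : ℝ≥0∞, (b ^ (1 / 3 : ℝ)) ^ 3 = b := fun b => by
    rw [show (1 / 3 : ℝ) = ((3 : ℕ) : ℝ)⁻¹ by norm_num, ENNReal.rpow_inv_natCast_pow (by norm_num)]
  calc ∫⁻ t in Ioo 0 τ, ∫⁻ x, ‖us j (t + s) (x + h) - us j t x‖ₑ ^ 3
      = ((∫⁻ t in Ioo 0 τ, ∫⁻ x, ‖us j (t + s) (x + h) - us j t x‖ₑ ^ 3) ^ (1 / 3 : ℝ)) ^ 3 :=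
        (hcube _).symm
    _ ≤ (ENNReal.ofReal ε ^ (1 / 3 : ℝ)) ^ 3 := by gcongr
    _ = ENNReal.ofReal ε := hcube _

end Summit.AnomalousDissipation.AnomalousDissipation.Theorems

end
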